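import Summits.Ventures.CertifiedManyBodySolver.Observables.StiffnessApexTransportCurtain
import HarnessLib

/-!
# Ventures/CertifiedManyBodySolver — Observables/StiffnessApexTransportStem.lean

HONEST FRAMING: one-sided certified CEILINGS on the uniform flux stiffness (`t–t′` f-sum class) at half filling, TRANSPORTED from sources
on ONE VERTICAL LINE `t′ = p` (a «stem»); a ceiling never speaks to the presence of order; not a `T_c` estimate, not a superconductivity
verdict; every leaf is CONDITIONAL on the row family it names. Zero compute, no definition, no claim node, no `sorry`.

Cell `pub/hubbard-downfold` (D-0150 L-DF2 «box ↦ one word»), seat `hubbard-downfold-unc-2` (`prover-hubbard-downfold-unc-2-g17-0`); sequel of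
`Observables/StiffnessApexTransportCurtain.lean` (§1 slot ENGINE, §2 the «curtain», §3 (E2) the «L» = bottom inner segment + left edge).

THE POINT. The apex segment of a target `P = (t′, U)` (`t′ < 0`, `U > 0`) is the straight segment from the apex `(2t′, 0)` to `P`; it meets
the vertical line `t′ = p` (`p ≤ t′`) at the height `U′ = U(2 − p/t′) ∈ (0, U]` (`leftEdge_apexSource`). At half filling a source `A = (p, U′)`
on that line words `P` from its OWN f-sum word (slot `σ = p ≤ t′`, §1 engine of the companion). So an own-word orbit-lower family on a stem
`{p} × [U₀, U_L]` words EVERY target `(t′, U)` with `p ≤ t′ < 0` and `U₀ ≤ U(2 − p/t′) ≤ U_L` — and nothing requires `U₀` to be the bottom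
of anybody's box: the stem may continue BELOW the box («foot»). For a box `[p, q] × [U_A, U_max]` with `q < 0` the heights `U(2 − p/t′)`
fill `[U_A(2 − p/q), U_max]`, so

* §1 `ObsStiffnessSeqCeilingAt_halfFilling_of_leftLine_orbitLower` — the POINT form (one target, its source on the stem);
* §2 geometry of the source height `U(2 − p/t′)`: monotone envelope on a box (`leftLine_source_mem_Icc`), and «station source `≤ p` iff stem
  source `≥` the station» in the non-strict form (`station_le_leftLine_source_of_stationSource_le`);
* §3 `ObsStiffnessSeqCeilingAt_halfFilling_on_box_of_leftStem_orbitLower` — the «I» edition: ONE own-word family on the stem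
  `{p} × [U₀, U_L]` with `U₀ ≤ U_A(2 − p/q)`, `U_max ≤ U_L` words the whole box `[p, q] × [U_A, U_max]` (no bottom bundle, no overhang, no slot
  read, no `K₂` leg); `…_above_station_of_leftLine_orbitLower` — the family on `{p} × [U_S, U_L]` words every target whose station-`U_S` source
  `t′(2U − U_S)/U` lies at or beyond `p` (the «transport shadow» of the station) and whose stem source is `≤ U_L`.

WHAT CHANGES FOR THE PLANNER (planning arithmetic, [float]): the (E1)/(E2) editions word the box from the station row `U = U_A` (inner bundle +
overhang or + left edge); the stem words it from `U`-SEGMENT bundles on `t′ = p` only, whose a-priori scale is `k(p)` at every source and whose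
low end `U₀ = U_A(2 − p/q)` lies below the box (La214-E `[−3/10, −1/5] × [29/5, 74/5]`: `U₀ = 2.9` for the whole box; `58/11 ≈ 5.27` for the residual
strip `t′ ≤ −11/40`, instance file `Downfold/BoxesLa214V115M2bLeftStem.lean`). Which object is cheaper to certify is the solver's call.

NOT said: nothing flows toward smaller `U`; only `n = 1` here (at `n ≠ 1` the stem needs target-slot reads, `σ ∈ [p/(2 − U′/U_max), p]` per
source — the companion `…TargetSlot` device); `λ ≠ 0` words are not of this form; no `T > 0`; no number of record.

References: T. Koma, H. Tasaki, J. Stat. Phys. 76 (1994) 745, §1 [KomaTasaki1994]; D. J. Scalapino, S. R. White, S.-C. Zhang, PRB 47 (1993)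
7995, §II [ScalapinoWhiteZhang1993].
-/

noncomputable section

namespace Summit.Ventures.CertifiedManyBodySolver.Observables

open Literature.MathematicalPhysics.QuantumLattice
open Literature.MathematicalPhysics.QuantumLattice.ThermodynamicLimit
open Literature.MathematicalPhysics.QuantumFieldTheory
open Literature.Probability.LatticeModels
open Matrix Finset Filter Topology HubbardWave0
open scoped Matrix BigOperators ComplexOrder

/-! ## §1 POINT FORM: a target is worded by the stem source at the height where its apex segment crosses `t′ = p` -/

section Point

variable {p U₀ UL : ℝ}

/-- **Left-line (stem) transport, point form (half filling).** An own-word orbit-lower family `valL` on the stem `{p} × [U₀, U_L]`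
(`0 ≤ U₀`): for every `U′ ∈ [U₀, U_L]`, every torus limit of unit `(rectN 1 L, S^z = 0)`-sector ground states of `hubbardTorusTT' L 1 p U′`
has `valL U′ ≤ |D₄|⁻¹ Σ_γ Re ω(Γ_γ(−X₀(p, U′)))`, with `−valL U′ ≤ c`. Then every target `(t′, U)` with `p ≤ t′ < 0`, `0 < U` and
`U₀ ≤ U(2 − p/t′) ≤ U_L` carries `ObsStiffnessSeqCeilingAt t′ U 1 c`: its apex segment crosses the stem at the height `U(2 − p/t′) ≤ U`
(`leftEdge_apexSource`) and the slot `σ = p ≤ t′` is admissible (`2p − 2t′ = k·p`, `k = 2(p − t′)/p ≥ 0`).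
[cite: KomaTasaki1994, §1] [cite: ScalapinoWhiteZhang1993, §II] -/
theorem ObsStiffnessSeqCeilingAt_halfFilling_of_leftLine_orbitLower (hU₀ : 0 ≤ U₀) (valL : ℝ → ℝ) (c : ℚ)
    (hL : ∀ U' ∈ Set.Icc U₀ UL,
      ∀ (ω : InfVolFermionState 2) (Ls : ℕ → ℕ) (ψ : ∀ L, Fock (Orb (FermionTorus 2 L))),
      Tendsto Ls atTop atTop →
      (∀ j, IsGroundStateInSector (hubbardTorusTT' (Ls j) 1 p U') (rectN 1 (Ls j)) 0 (ψ (Ls j))) →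
      (∀ j, star (ψ (Ls j)) ⬝ᵥ ψ (Ls j) = 1) → ω.IsTorusLimitOf ψ Ls →
      valL U' ≤ ((Finset.univ : Finset (DihedralGroup 4)).card : ℝ)⁻¹ * ∑ g ∈ (Finset.univ : Finset (DihedralGroup 4)),
        (ω.expect (d4ShiftSet g 0 (box 2 7)) (fermionEmbed (PolySite.d4Emb g 0 (box 2 7)) (-oddMomentObsTT p U' 0))).re)
    (hcL : ∀ U' ∈ Set.Icc U₀ UL, -valL U' ≤ ((c : ℚ) : ℝ))
    {tp U : ℝ} (htp : p ≤ tp) (ht0 : tp < 0) (hU : 0 < U) (h₀ : U₀ ≤ U * (2 - p / tp)) (h₁ : U * (2 - p / tp) ≤ UL) :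
    ObsStiffnessSeqCeilingAt tp U 1 c := by
  have hp0 : p < 0 := lt_of_le_of_lt htp ht0
  obtain ⟨hU'le, hapex⟩ := leftEdge_apexSource htp ht0 hU
  have hmem : U * (2 - p / tp) ∈ Set.Icc U₀ UL := ⟨h₀, h₁⟩
  have hk : 0 ≤ 2 * (p - tp) / p := div_nonneg_of_nonpos (by linarith) hp0.le
  have hslot : 2 * p - 2 * tp = 2 * (p - tp) / p * p := by
    rw [div_mul_cancel₀ _ hp0.ne]; ring
  exact ObsStiffnessSeqCeilingAt_halfFilling_of_apexSource_orbitLower_slot p (U * (2 - p / tp)) (valL (U * (2 - p / tp)))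
    (hU₀.trans h₀) hU'le hU hapex (hL _ hmem) hk hslot c (hcL _ hmem)

end Point

/-! ## §2 GEOMETRY of the stem source height `U(2 − p/t′)` -/

section Geometry

/-- **Envelope of the stem source over a box.** For `p ≤ t′ ≤ q < 0`, `2q ≤ p` (the line `t′ = p` is not left of the apex `2q`) and
`0 < U_a ≤ U ≤ U_b`: `U_a(2 − p/q) ≤ U(2 − p/t′) ≤ U_b` (`1 ≤ p/t′ ≤ p/q ≤ 2`). [folklore] -/
theorem leftLine_source_mem_Icc {p q tp Ua Ub U : ℝ} (hq : q < 0) (h2 : 0 ≤ 2 - p / q) (htp : tp ∈ Set.Icc p q) (hUa : 0 < Ua)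
    (hU : U ∈ Set.Icc Ua Ub) : U * (2 - p / tp) ∈ Set.Icc (Ua * (2 - p / q)) Ub := by
  have ht0 : tp < 0 := lt_of_le_of_lt htp.2 hq
  have hU0 : 0 < U := hUa.trans_le hU.1
  refine ⟨?_, (leftEdge_apexSource htp.1 ht0 hU0).1.trans hU.2⟩
  have hp : p ≤ 0 := (htp.1.trans htp.2).trans hq.le
  have h1 : p / tp ≤ p / q := by
    have h := div_le_div_of_nonneg_left (a := -p) (b := -tp) (c := -q) (by linarith) (by linarith) (by linarith [htp.2])
    rwa [neg_div_neg_eq, neg_div_neg_eq] at h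
  have h3 : 2 - p / q ≤ 2 - p / tp := by linarith
  exact (mul_le_mul_of_nonneg_right hU.1 h2).trans (mul_le_mul_of_nonneg_left h3 hU0.le)

/-- **Station source at or beyond `p` ⇔ stem source at or above the station (non-strict).** For a target `(t′, U)` with `t′ < 0 < U` and a
station height `U_S`: if the station-`U_S` source `t′(2U − U_S)/U ≤ p` then `U_S ≤ U(2 − p/t′)` (companion of the strict
`apexSource_lt_iff_station_lt_leftEdge`). [folklore] -/
theorem station_le_leftLine_source_of_stationSource_le {p tp U US : ℝ} (ht0 : tp < 0) (hU : 0 < U)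
    (hs : tp * (2 * U - US) / U ≤ p) : US ≤ U * (2 - p / tp) := by
  by_contra hlt
  have hlt : U * (2 - p / tp) < US := not_le.mp hlt
  -- the strict companion gives `p < station source`... in the other direction; argue directly
  have e1 : tp * (2 * U - US) / U = tp * (2 - US / U) := by field_simp
  have e2 : U * (2 - p / tp) = 2 * U - U * p / tp := by ring
  rw [e1] at hs
  rw [e2] at hlt
  -- from `hs`: `p/tp ≤ 2 − US/U` (divide by `tp < 0`)
  have h' : p / tp ≤ 2 - US / U := by rwa [div_le_iff_of_neg ht0, mul_comm]
  have h'' : U * (p / tp) ≤ U * (2 - US / U) := mul_le_mul_of_nonneg_left h' hU.le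
  have e3 : U * (2 - US / U) = 2 * U - US := by field_simp
  have e4 : U * (p / tp) = U * p / tp := by ring
  linarith [h'', e3, e4]

/-- **The stem source lies at or below the target** (`U(2 − p/t′) ≤ U` for `p ≤ t′ < 0 < U`) and satisfies the apex relation — re-export of
`leftEdge_apexSource` under the stem name. [folklore] -/
theorem leftLine_source_le {p tp U : ℝ} (htp : p ≤ tp) (ht0 : tp < 0) (hU : 0 < U) : U * (2 - p / tp) ≤ U :=
  (leftEdge_apexSource htp ht0 hU).1

end Geometry

/-! ## §3 THE «I» EDITION: one stem words a box; the stem above a station words the station's transport shadow -/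

section Stem

variable {p q UA Umax U₀ UL US : ℝ}

/-- **THE STEM THEOREM (half filling): ONE VERTICAL LINE WORDS A BOX.** Box `[p, q] × [U_A, U_max]` with `p ≤ q < 0 < U_A`. An own-word
orbit-lower family `valL` on the stem `{p} × [U₀, U_L]` with `0 ≤ U₀ ≤ U_A(2 − p/q)` and `U_max ≤ U_L`, priced `−valL ≤ c`, gives
`ObsStiffnessSeqCeilingAt t′ U 1 c` at EVERY point of the box: the stem source height `U(2 − p/t′)` of a box target lies in
`[U_A(2 − p/q), U_max] ⊆ [U₀, U_L]` (`leftLine_source_mem_Icc`). No bottom bundle, no overhang, no slot read, no `K₂` leg; the foot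
`[U₀, U_A)` of the stem lies BELOW the box whenever `|q| < |p|` (and `0 ≤ U₀` forces `2q ≤ p`: the line is not left of any apex).
[cite: KomaTasaki1994, §1] [cite: ScalapinoWhiteZhang1993, §II] -/
theorem ObsStiffnessSeqCeilingAt_halfFilling_on_box_of_leftStem_orbitLower (hpq : p ≤ q) (hq : q < 0) (hUA : 0 < UA)
    (hU₀ : 0 ≤ U₀) (hfoot : U₀ ≤ UA * (2 - p / q)) (htop : Umax ≤ UL) (valL : ℝ → ℝ) (c : ℚ)
    (hL : ∀ U' ∈ Set.Icc U₀ UL,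
      ∀ (ω : InfVolFermionState 2) (Ls : ℕ → ℕ) (ψ : ∀ L, Fock (Orb (FermionTorus 2 L))),
      Tendsto Ls atTop atTop →
      (∀ j, IsGroundStateInSector (hubbardTorusTT' (Ls j) 1 p U') (rectN 1 (Ls j)) 0 (ψ (Ls j))) →
      (∀ j, star (ψ (Ls j)) ⬝ᵥ ψ (Ls j) = 1) → ω.IsTorusLimitOf ψ Ls →
      valL U' ≤ ((Finset.univ : Finset (DihedralGroup 4)).card : ℝ)⁻¹ * ∑ g ∈ (Finset.univ : Finset (DihedralGroup 4)),
        (ω.expect (d4ShiftSet g 0 (box 2 7)) (fermionEmbed (PolySite.d4Emb g 0 (box 2 7)) (-oddMomentObsTT p U' 0))).re)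
    (hcL : ∀ U' ∈ Set.Icc U₀ UL, -valL U' ≤ ((c : ℚ) : ℝ)) :
    ∀ tp ∈ Set.Icc p q, ∀ U ∈ Set.Icc UA Umax, ObsStiffnessSeqCeilingAt tp U 1 c := by
  intro tp htp U hU
  have _ := hpq
  have ht0 : tp < 0 := lt_of_le_of_lt htp.2 hq
  have hU0 : 0 < U := hUA.trans_le hU.1
  -- the foot is nonnegative, so the line `t′ = p` is not left of the apex `2q`
  have h2 : 0 ≤ 2 - p / q := by
    by_contra h
    have := mul_neg_of_pos_of_neg hUA (not_le.mp h)
    linarith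
  obtain ⟨hlo, hhi⟩ := leftLine_source_mem_Icc (p := p) hq h2 htp hUA hU
  exact ObsStiffnessSeqCeilingAt_halfFilling_of_leftLine_orbitLower hU₀ valL c hL hcL htp.1 ht0 hU0 (hfoot.trans hlo)
    (hhi.trans htop)

/-- **THE STEM ABOVE A STATION WORDS THE STATION'S TRANSPORT SHADOW.** An own-word orbit-lower family `valL` on `{p} × [U_S, U_L]`
(`0 ≤ U_S`), priced `−valL ≤ c`. Then every target `(t′, U)` with `p ≤ t′ < 0 < U` whose station-`U_S` apex source lies at or beyond the
line, `t′(2U − U_S)/U ≤ p`, and whose stem source is not above the family, `U(2 − p/t′) ≤ U_L`, carries `ObsStiffnessSeqCeilingAt t′ U 1 c`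
(`station_le_leftLine_source_of_stationSource_le`). This is the (E2) «L» without its bottom bundle, cut at `U_L`: the region a box seat
calls the transport fan / overhang shadow of the station is worded from INSIDE the line `t′ = p`, `U ∈ [U_S, U_L]`.
[cite: KomaTasaki1994, §1] [cite: ScalapinoWhiteZhang1993, §II] -/
theorem ObsStiffnessSeqCeilingAt_halfFilling_above_station_of_leftLine_orbitLower (hUS : 0 ≤ US) (valL : ℝ → ℝ) (c : ℚ)
    (hL : ∀ U' ∈ Set.Icc US UL,
      ∀ (ω : InfVolFermionState 2) (Ls : ℕ → ℕ) (ψ : ∀ L, Fock (Orb (FermionTorus 2 L))),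
      Tendsto Ls atTop atTop →
      (∀ j, IsGroundStateInSector (hubbardTorusTT' (Ls j) 1 p U') (rectN 1 (Ls j)) 0 (ψ (Ls j))) →
      (∀ j, star (ψ (Ls j)) ⬝ᵥ ψ (Ls j) = 1) → ω.IsTorusLimitOf ψ Ls →
      valL U' ≤ ((Finset.univ : Finset (DihedralGroup 4)).card : ℝ)⁻¹ * ∑ g ∈ (Finset.univ : Finset (DihedralGroup 4)),
        (ω.expect (d4ShiftSet g 0 (box 2 7)) (fermionEmbed (PolySite.d4Emb g 0 (box 2 7)) (-oddMomentObsTT p U' 0))).re)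
    (hcL : ∀ U' ∈ Set.Icc US UL, -valL U' ≤ ((c : ℚ) : ℝ))
    {tp U : ℝ} (htp : p ≤ tp) (ht0 : tp < 0) (hU : 0 < U) (hs : tp * (2 * U - US) / U ≤ p) (h₁ : U * (2 - p / tp) ≤ UL) :
    ObsStiffnessSeqCeilingAt tp U 1 c :=
  ObsStiffnessSeqCeilingAt_halfFilling_of_leftLine_orbitLower hUS valL c hL hcL htp ht0 hU
    (station_le_leftLine_source_of_stationSource_le ht0 hU hs) h₁

/-- **CHORD FORM of the stem family** (what a two-vertex shared-dual `U`-segment bundle delivers): vertex values `v₁` at `U₁` and `v₂` at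
`U₂` (`U₁ < U₂`) with `−v₁, −v₂ ≤ c`; the affine interpolant `valL U′ = ((U₂ − U′)v₁ + (U′ − U₁)v₂)/(U₂ − U₁)` is priced `−valL U′ ≤ c` on
`[U₁, U₂]` (convexity). [cite: ScalapinoWhiteZhang1993, §II] -/
theorem neg_uChord_le_of_neg_vertices_le {U₁ U₂ v₁ v₂ : ℝ} (h12 : U₁ < U₂) (c : ℚ) (hc₁ : -v₁ ≤ ((c : ℚ) : ℝ))
    (hc₂ : -v₂ ≤ ((c : ℚ) : ℝ)) :
    ∀ U' ∈ Set.Icc U₁ U₂, -(((U₂ - U') * v₁ + (U' - U₁) * v₂) / (U₂ - U₁)) ≤ ((c : ℚ) : ℝ) := by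
  intro U' hU'
  have hd : 0 < U₂ - U₁ := sub_pos.mpr h12
  rw [neg_le, le_div_iff₀ hd]
  have hw₁ : 0 ≤ U₂ - U' := sub_nonneg.mpr hU'.2
  have hw₂ : 0 ≤ U' - U₁ := sub_nonneg.mpr hU'.1
  nlinarith [mul_le_mul_of_nonneg_left (neg_le.mp hc₁) hw₁, mul_le_mul_of_nonneg_left (neg_le.mp hc₂) hw₂]

end Stem

end Summit.Ventures.CertifiedManyBodySolver.Observables

end
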